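import Literature.MathematicalPhysics.QuantumFieldTheory.Balaban1983to89.B9Eq326G1SupRowAdjoint
import Literature.MathematicalPhysics.QuantumFieldTheory.Balaban1983to89.B9Eq326WoodburyLettersTower
import Literature.MathematicalPhysics.QuantumFieldTheory.Balaban1983to89.B9Eq326WoodburySchurTower
import Literature.MathematicalPhysics.QuantumFieldTheory.Balaban1983to89.B9Eq326LocalPartTowerSupDecayDiagonalClosed
import Literature.MathematicalPhysics.QuantumFieldTheory.Balaban1983to89.B9Eq326DeltaABlockDecayTowerDiagonalClosed
import Literature.MathematicalPhysics.QuantumFieldTheory.Balaban1983to89.B9Eq326LocalPartCoerciveTower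
import Literature.MathematicalPhysics.QuantumFieldTheory.Balaban1983to89.B9Eq342GreenPrimeTowerGradientRowClosed
import Literature.MathematicalPhysics.QuantumFieldTheory.Balaban1983to89.B9Eq324PenaltyPointwiseBound
import Literature.MathematicalPhysics.QuantumFieldTheory.Balaban1983to89.B9Eq33CovDerivLocalLetterTower

/-!
# `Balaban1983to89.B9Eq326G1kSupRowClosed` — T. Bałaban, *Propagators for lattice gauge theories in a background field*, Commun. Math. Phys. **99** (1985)
# 389–434 [Balaban1985BackgroundPropagators] Thm 3.3 p. 399 (*«the operator G(U) satisfies the inequalities (3.42)–(3.47), with G′(U) replaced by G(U) and λ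
# replaced by a function defined at bonds»*), Thm 3.1 (3.42) p. 397, (3.25)–(3.27) pp. 394–395, Thm 3.11 p. 416: **THE SUP ROW OF THE TOWER BOND PROPAGATOR
# `G₁,k(U) = Δ_{a,k}(U)⁻¹` ON PRINT's DIAGONAL WITH `∃ (α₁, B, δ)` BEFORE THE HEIGHT, THE PERIOD AND THE BACKGROUND — beta-an4's INTERFACE REQUEST D4
# `exists_local_letter_G1k` (journal `HOME/CLAIMS.log` l.64394) — MODULO ONE DISPLAYED `∃`-FIRST LETTER: the sup row of `Uu = D_UG′_kQ̃′_k†` on unit point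
# sources (`HU`, §1) — AND UNCONDITIONALLY (§2), `HU` inhabited by the NE9 owner's `B9Eq342GreenPrimeTowerGradientRowClosed.exists_gradRow_GpOfUk` + `Q̃′_k†`'s
# range∕size letters** — the INSTANTIATION of this lineage's abstract Woodbury assembly `B9Eq326G1SupRowAdjoint.local_letter_G1_torus_const`
# at the tower (END typist: this lineage, t4-ne9-p1 g95 A-1 l.65067; plan memo `t4/b2b-balaban-t4-ne9-formalise-leaf-05/g87/K64-END-PLAN-g87.md`)

statement-level skeleton of published theorems with citation tags; proofs where landed; nothing here is a claim about the Yang–Mills mass gap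

CITATION HEADER (lean-in-tree rule).  Audit cell `pub-balaban`, sub-cell `t4`, BINDER row NE9; filed by NE9 crux-team LEAF PROVER 05
(`b2b-balaban-t4-ne9-formalise-leaf-05`, gen 87).  Composed BY NAME, nothing restated: (K62) `B9Eq326G1SupRowAdjoint.local_letter_G1_torus_const` (the algebra);
(WST) ne9-leaf-03's `B9Eq326WoodburySchurTower.G1k_eq_woodbury` (the identity, `hW`); (K64a) `B9Eq326WoodburyLettersTower.adjoint_toContinuousLinearMap_Uu` ∕
`adjoint_localInvK` ∕ `exists_local_letter_QGGQInvk_closed` (`hVadj`, `hAadj`, `hC`); (ECL) ne9-leaf-03's `B9Eq326LocalPartTowerSupDecayDiagonalClosed.exists_sup_decay_localInvK_diagonal_closed`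
((L)(A₀,k⁻¹)) and §1 `sum_bondMass_bigBlock_le` (the bond-block mass `d·c₁`); (FCLG) ne9-leaf-03's `B9Eq326DeltaABlockDecayTowerDiagonalClosed.exists_block_decay_G1k_diagonal_closed`
(`hGblk`); (LPC) `B9Eq326LocalPartCoerciveTower.localK_pos_of_pos` (`hpos₀` free from Thm 3.11's `hpos`); ne9-leaf-01's `B9Eq349BlockMultipliers.exists_block_clm_family`
(the two block families); `B9Eq310HessianHermitian.adTransportW_adjoint` (`hRS` from unitarity).  Sources READ first-hand this generation (`paper:balaban1985-cmp99-background-propagators`,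
journal page = PDF page + 388): p. 394 (3.25), p. 395 (3.26)–(3.27), p. 397 Thm 3.1 (3.42), p. 399 (3.49) + Thm 3.3.  Print proves Thm 3.3 by the random walk of
Sect. C; NOTHING of that proof is reproduced and no constant of print is valued — the cell's road is (ECL) (Kato bootstrap) + storey J (`HU`) + Combes–Thomas
((FCLG)) + Woodbury ((WST)) + (L)-algebra ((K61)∕(K62)).

WHAT IS PROVED (sorry-free; proof lane — no `def`; [folklore] composition BY NAME + `min`∕`exp` bookkeeping).
* §2 **`exists_local_letter_G1k`** — THE SAME, UNCONDITIONAL on the cell's MODEL letters: `HU` INHABITED by the NE9 owner's (GRC)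
  `B9Eq342GreenPrimeTowerGradientRowClosed.exists_gradRow_GpOfUk` read on the unit point sources `h = Q̃′_k†g` (support by `adjoint_QtildeTower_apply_eq_of_eq_at` +
  `bigBlock_eq_iff`; size `‖h‖_∞ ≤ ‖g‖_∞` on the diagonal by `norm_adjoint_QtildeTower_apply_le` × `norm_le_sqrt_mass_mul`; the tip ∕ base junction
  `tdist_bigBlock_bpos_btgt_le_one`, factor `e^{κ′}`) — beta-an4's `exists_local_letter_G1k` LITERALLY (binder block as below).
* §1 **`exists_local_letter_G1k_of_UuLetter`** — GIVEN `HU : ∃ α₂ B_U κ_U > 0, ∀ ⟨the data block below⟩ (hpos′) (v g G), (g supported at the unit site v,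
  ‖g‖_∞ ≤ G) → ∀ b, ‖(D_UG′_kQ̃′_k†g)(b)‖ ≤ B_U·e^{−κ_U·d_m(Π(b₋), v)}·G`: **`∃ α₁ B δ, 0 < α₁ ∧ 0 ≤ B ∧ 0 < δ ∧ ∀ (n η) (ηL^{n+1} = 1) (c₀ c₁) (c₀(L^{n+1})^d = c₁)
  (|η|^d∕c₀ ≤ ρ_w) (m) (1 ≤ m_i) (U) ⟨level data αU hα0 hα1 hU1 hreg εU hεU hUε hLb; window α hα (α ≤ α₁) hUst hUb hUη hpl hUgrad hRlev hεg hAQ⟩ (hpos′) (hpos) (v f F),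
  (f supported over Π⁻¹(v) by `blockCoord (L^(n+1)) m (siteCast … (bpos b))`) → (‖f(b)‖ ≤ F) → ∀ b, ‖(G1k L m n φ η U hL αU hα1 hU1 hreg τ hpos f)(b)‖ ≤ B·e^{−δ·tdist m (Π(bpos b)) v}·F`**
  — `α₁ := min` of the four suppliers' thresholds ((ECL), (FCLG), (K64a), `HU`), common rate `κ := min(δ_A, r₁, ρ_c, κ_U)` (each letter weakened by `e^{−rt} ≤ e^{−κt}`),
  `δ := κ∕2`, `B := B_A + B_A·B_U·B_c·(B_U·B_A·K·d)·K³·(1 + B_c·((B_U√d)·A₁·(B_U√d)·K²)·K²)`, `K = K_d(κ∕4)` — HEIGHT-, VOLUME-, WEIGHT- and BACKGROUND-FREE.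
  The binder list is the (ECL)∕(FCLG) convention + `hUgrad` (the bond-gradient datum of (3.35), read with the same `α`) + `hRlev` (contractive level transporters,
  the owner's T-D convention) + both positivity witnesses — ACCEPTED by
  the consumer (beta-an4 g110 W-5, journal l.65113: data-class binders after the `∀` travel to NODE E verbatim).
HONEST SCOPE.  The END of the crew's `G₁,k` sup-row programme: §1 MODULO `HU`, §2 unconditional on the MODEL letters (the gradient row of `G′_k` = storey J at the
tower — this lineage's (K41) engine in the owner's (GT)∕(GTD)∕(GRC) — consumed BY NAME); constants crude; nothing of [B9] Thm 3.1 ∕ 3.3 ∕ 3.11 is asserted, valued or discharged beyond what the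
named files prove on the cell's MODEL (a background small on every bond with the bond-gradient datum; positivity of `Δ_{a,k}`, `Δ′_{a′,k}` DISPLAYED as
`hpos`, `hpos′`).  «NE9 ⇐ the named binders»; NE9 NOT PRINTED ∕ NOT PROVED; row WALLED ON A MODEL (O-NE9-1; #5 UNRULED); spine PROVED 0∕9; rung (B)+1 on a finite
T⁴ — NOT infinite volume, NOT mass gap, NOT BetaPertH, NOT Clay.  HONEST DEPENDENCY: continuum YM on T⁴ ⇐ BetaPertH ∧ nine spine estimates (0/9 proved);
BetaPertH ⇐ (D1) ∧ (D4) ∧ CAP+tail; G-an2-4 gates asym, D1 and NE2/3/4.  NEW file behind (K62), (K64a), (WST), (GRC) (oleans); nothing modified.  Net new unproved facts: 0.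
-/

noncomputable section

set_option autoImplicit false

open scoped InnerProductSpace ComplexConjugate BigOperators

namespace Literature.MathematicalPhysics.QuantumFieldTheory.Balaban1983to89.B9Eq326G1kSupRowClosed

open B4Sect5Torus (TSite tdist tdist_nonneg)
open B4Sect5Proof (latticeConst latticeConst_nonneg)
open B9SectCLatticeCarrier (Bond DirPair bpos btgt unshift)
open B9Eq311L2Pairing (WL2)
open B9Eq319QprimeTorus (fineP blockCoord)
open B7Prop1Explicit (U1 Wcx boxVec)
open B11Eq103H1Complex (SiteL2K BondL2K greenK covDerivL2K covDivL2K)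
open B9Eq310DeltaPrime (plaqHolU)
open B9Eq310HessianOperator (adTransportW hessOp)
open B9Eq310HessianHermitian (adTransportW_adjoint)
open B9Eq315QTorus (perCfg cornerSite)
open B9Eq315QTower (towerP UlevOf)
open B9Eq316TowerFlatIsOneStep (towerP_eq_fineP_pow siteCast)
open B9Eq326OperatorTower (QkW QprimeTowerW laplaceAk G1k)
open B9Eq324DeltaPrimeATower (laplacePrimeAk GpOfUk)
open B9Eq325ProjFormulaTower (QGGQk_pos)
open B9Eq349BlockMultipliers (exists_block_clm_family)
open B9Eq326LocalPartCoerciveTower (localK_pos_of_pos)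
open B9Eq326WoodburySchurTower (G1k_eq_woodbury)
open B9Eq326WoodburyLettersTower (adjoint_toContinuousLinearMap_Uu adjoint_localInvK exists_local_letter_QGGQInvk_closed)
open B9Eq326LocalPartTowerSupDecayDiagonalClosed (sum_bondMass_bigBlock_le exists_sup_decay_localInvK_diagonal_closed)
open B9Eq326DeltaABlockDecayTowerDiagonalClosed (exists_block_decay_G1k_diagonal_closed)
open B9Eq326G1SupRowAdjoint (local_letter_G1_torus_const)
open B9Eq342GreenPrimeTowerGradientRowClosed (exists_gradRow_GpOfUk)
open B9Eq324PenaltyPointwiseBound (norm_adjoint_QtildeTower_apply_le)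
open B9Eq324PenaltyBlockLocal (adjoint_QtildeTower_apply_eq_of_eq_at)
open B9Eq342GreenPrimeTowerSupBoundDecay (bigBlock_eq_iff)
open B9Eq33CovDerivLocalLetterTower (tdist_bigBlock_bpos_btgt_le_one)
open B9Eq347LocalFromBlockDecay (norm_le_sqrt_mass_mul)
open B4Sect5Torus (tdist_triangle)

variable {d : ℕ} (hd : 1 ≤ d) (L : ℕ) [NeZero L] (hL : 1 ≤ L) (hL3 : 3 ≤ L)
  {𝔸 : Type*} [NormedRing 𝔸] [NormedAlgebra ℂ 𝔸] [CompleteSpace 𝔸] [NormOneClass 𝔸] [StarRing 𝔸] [NormedStarGroup 𝔸] [StarModule ℂ 𝔸]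
  {W : Type*} [NormedAddCommGroup W] [InnerProductSpace ℂ W] [FiniteDimensional ℂ W] (φ : W ≃ₗ[ℂ] 𝔸)
  {Mφ Mφ' : ℝ} (hMφ : 0 ≤ Mφ) (hMφ' : 0 ≤ Mφ') (hφ : ∀ w, ‖φ w‖ ≤ Mφ * ‖w‖) (hφ' : ∀ X, ‖φ.symm X‖ ≤ Mφ' * ‖X‖) (hstar : ∀ X : 𝔸, ‖star X‖ ≤ ‖X‖)
  {a : ℝ} (ha : 0 < a) {a' : ℝ} (ha' : 0 < a') {ϱ : ℝ} (hϱ0 : 0 ≤ ϱ) (hϱ1 : ϱ < 1)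
  (τ : 𝔸 →ₗ[ℂ] ℂ) {Cτ : ℝ} (hτ : ∀ X, ‖τ X‖ ≤ Cτ * ‖X‖) (hCτ : 0 ≤ Cτ) {Mτ : ℝ} (hτm : ∀ X Y : 𝔸, ‖τ (X * Y)‖ ≤ Mτ * ‖X‖ * ‖Y‖) (hMτ : 0 ≤ Mτ)
  {ρw : ℝ} (hρw : 0 ≤ ρw)
  (hτ₁ : ∀ X : 𝔸, τ (star X) = conj (τ X)) (hτ₂ : ∀ X Y : 𝔸, τ (X * Y) = τ (Y * X)) (hφτ : ∀ X Y : 𝔸, ⟪φ.symm X, φ.symm Y⟫_ℂ = τ (star X * Y))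
  (AQ : ℝ)

/-! ## §0 Small real letters -/

omit [NeZero L] in
/-- `e^{−r t} ≤ e^{−κ t}` for `κ ≤ r`, `0 ≤ t`. [folklore] -/
private theorem exp_weaken {r κ t : ℝ} (hκ : κ ≤ r) (ht : 0 ≤ t) : Real.exp (-(r * t)) ≤ Real.exp (-(κ * t)) :=
  Real.exp_le_exp.2 (by nlinarith)

/-! ## §1 The END modulo the letter of `Uu = D_UG′_kQ̃′_k†` -/

include hd hL hL3 hMφ hMφ' hφ hφ' hstar ha ha' hϱ0 hϱ1 hτ hCτ hτm hMτ hρw hτ₁ hτ₂ hφτ in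
/-- **THE SUP ROW OF `G₁,k(U)` ON PRINT's DIAGONAL, `∃ α₁ B δ` BEFORE THE HEIGHT — MODULO THE DISPLAYED `∃`-FIRST LETTER OF `Uu = D_UG′_kQ̃′_k†`**
(`HU`, to be supplied by the OWNER's `B9Eq342GreenPrimeTowerGradientRowClosed.exists_gradRow_GpOfUk` through `B9Eq326G1SupRowAdjoint.letter_U_of_gradientRow`
+ `B9Eq326G1SupRowOfLetters.letter_reblock`): beta-an4's `exists_local_letter_G1k` shape.  Composition BY NAME of `local_letter_G1_torus_const` with `hW` :=
`G1k_eq_woodbury`, `hVadj`∕`hAadj`∕`hC` := `B9Eq326WoodburyLettersTower`, (L)(A₀,k⁻¹) := (ECL), `hGblk` := (FCLG), the families by `exists_block_clm_family`,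
the bond-block mass `d·c₁` by (ECL) §1. [cite: Balaban1985BackgroundPropagators, Thm 3.3 p.399, Thm 3.1 (3.42) p.397, (3.25)–(3.26) pp.394–395, Thm 3.11 p.416] -/
theorem exists_local_letter_G1k_of_UuLetter
    (HU : ∃ α₂ BU κU : ℝ, 0 < α₂ ∧ 0 ≤ BU ∧ 0 < κU ∧
      ∀ (n : ℕ) (η : ℝ) (_hηL : η * (L : ℝ) ^ (n + 1) = 1) (c₀ c₁ : ℝ) [Fact (0 < c₀)] [Fact (0 < c₁)]
        (_hw : c₀ * ((L : ℝ) ^ (n + 1)) ^ d = c₁) (_hρ : |η| ^ d / c₀ ≤ ρw) (m : Fin d → ℕ) [∀ i, NeZero (m i)] (_hm : ∀ i, 1 ≤ m i)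
        (U : Bond d (towerP L m (n + 1)) → 𝔸ˣ) (αU : ℕ → ℝ) (_hα0 : ∀ j, 0 ≤ αU j) (hα1 : ∀ j, αU j ≤ 1 / 64)
        (hU1 : ∀ (j : ℕ) (x : B7Prop1Explicit.Site d) (k : Fin d), perCfg (towerP L m (j + 1)) (UlevOf L m (n + 1) U j) x k ∈ U1 𝔸)
        (hreg : ∀ (j : ℕ) (y : TSite d (towerP L m j)) (k : Fin d) (ρ' : Fin d → Fin L),
          ‖((Wcx L (perCfg (towerP L m (j + 1)) (UlevOf L m (n + 1) U j)) (cornerSite L y) k (boxVec L ρ') : 𝔸ˣ) : 𝔸) - 1‖ ≤ αU j)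
        (εU : ℕ → ℝ) (_hεU : ∀ j, 0 ≤ εU j) (_hUε : ∀ (j : ℕ) (b : Bond d (towerP L m (j + 1))), ‖(UlevOf L m (n + 1) U j b : 𝔸) - 1‖ ≤ εU j)
        (_hLb : ∀ (j : ℕ) (b : Bond d (towerP L m (j + 1))), UlevOf L m (n + 1) U j b ∈ U1 𝔸)
        (α : ℝ) (_hα : 0 ≤ α) (_hαle : α ≤ α₂)
        (hUst : ∀ b, star (U b : 𝔸) = (((U b)⁻¹ : 𝔸ˣ) : 𝔸)) (_hUb : ∀ b, U b ∈ U1 𝔸) (_hUη : ∀ b, ‖(U b : 𝔸) - 1‖ ≤ α * η)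
        (_hpl : ∀ p : B9SectCLatticeCarrier.Plaq d (towerP L m (n + 1)), ‖(plaqHolU U p : 𝔸) - 1‖ ≤ α * η ^ 2)
        (_hUgrad : ∀ (x : TSite d (towerP L m (n + 1))) (μ : Fin d), ‖(U (x, μ) : 𝔸) - U (unshift μ x, μ)‖ ≤ α * η ^ 2)
        (_hRlev : ∀ (j : ℕ) (b : Bond d (towerP L m (j + 1))) (w : W), ‖adTransportW φ (UlevOf L m (n + 1) U j) b w‖ ≤ ‖w‖)
        (_hεg : ∀ j < n + 1, εU j ≤ α * ϱ ^ j) (_hAQ : ∑ j ∈ Finset.range (n + 1), αU j ≤ AQ)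
        (hpos' : ∀ x : SiteL2K ℂ d (towerP L m (n + 1)) c₀ W, x ≠ 0 → 0 < RCLike.re ⟪x, laplacePrimeAk L m n φ η U a' (c₁ := c₁) x⟫_ℂ)
        (v : TSite d m) (g : SiteL2K ℂ d m c₁ W) (Gs : ℝ) (_hgv : ∀ y, y ≠ v → WL2.equiv ℂ (fun _ : TSite d m => c₁) W g y = 0)
        (_hgG : ∀ y, ‖WL2.equiv ℂ (fun _ : TSite d m => c₁) W g y‖ ≤ Gs) (b : Bond d (towerP L m (n + 1))),
        ‖WL2.equiv ℂ (fun _ : Bond d (towerP L m (n + 1)) => c₀) W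
            ((covDerivL2K ℂ c₀ ((η : ℂ))⁻¹ (adTransportW φ U) ∘ₗ GpOfUk L m n φ η U a' (c₁ := c₁) hpos' ∘ₗ
              LinearMap.adjoint ((WL2.linearEquiv ℂ ℂ (fun _ : TSite d m => c₁)).symm.toLinearMap ∘ₗ QprimeTowerW L m n φ U (c₀ := c₀))) g) b‖ ≤
          BU * Real.exp (-(κU * tdist m (blockCoord (L ^ (n + 1)) m (siteCast (towerP_eq_fineP_pow L m (n + 1)) (bpos b))) v)) * Gs) :
    ∃ α₁ B δ : ℝ, 0 < α₁ ∧ 0 ≤ B ∧ 0 < δ ∧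
      ∀ (n : ℕ) (η : ℝ) (_hηL : η * (L : ℝ) ^ (n + 1) = 1) (c₀ c₁ : ℝ) [Fact (0 < c₀)] [Fact (0 < c₁)]
        (_hw : c₀ * ((L : ℝ) ^ (n + 1)) ^ d = c₁) (_hρ : |η| ^ d / c₀ ≤ ρw) (m : Fin d → ℕ) [∀ i, NeZero (m i)] (_hm : ∀ i, 1 ≤ m i)
        (U : Bond d (towerP L m (n + 1)) → 𝔸ˣ) (αU : ℕ → ℝ) (_hα0 : ∀ j, 0 ≤ αU j) (hα1 : ∀ j, αU j ≤ 1 / 64)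
        (hU1 : ∀ (j : ℕ) (x : B7Prop1Explicit.Site d) (k : Fin d), perCfg (towerP L m (j + 1)) (UlevOf L m (n + 1) U j) x k ∈ U1 𝔸)
        (hreg : ∀ (j : ℕ) (y : TSite d (towerP L m j)) (k : Fin d) (ρ' : Fin d → Fin L),
          ‖((Wcx L (perCfg (towerP L m (j + 1)) (UlevOf L m (n + 1) U j)) (cornerSite L y) k (boxVec L ρ') : 𝔸ˣ) : 𝔸) - 1‖ ≤ αU j)
        (εU : ℕ → ℝ) (_hεU : ∀ j, 0 ≤ εU j) (_hUε : ∀ (j : ℕ) (b : Bond d (towerP L m (j + 1))), ‖(UlevOf L m (n + 1) U j b : 𝔸) - 1‖ ≤ εU j)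
        (_hLb : ∀ (j : ℕ) (b : Bond d (towerP L m (j + 1))), UlevOf L m (n + 1) U j b ∈ U1 𝔸)
        (α : ℝ) (_hα : 0 ≤ α) (_hαle : α ≤ α₁)
        (hUst : ∀ b, star (U b : 𝔸) = (((U b)⁻¹ : 𝔸ˣ) : 𝔸)) (_hUb : ∀ b, U b ∈ U1 𝔸) (_hUη : ∀ b, ‖(U b : 𝔸) - 1‖ ≤ α * η)
        (_hpl : ∀ p : B9SectCLatticeCarrier.Plaq d (towerP L m (n + 1)), ‖(plaqHolU U p : 𝔸) - 1‖ ≤ α * η ^ 2)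
        (_hUgrad : ∀ (x : TSite d (towerP L m (n + 1))) (μ : Fin d), ‖(U (x, μ) : 𝔸) - U (unshift μ x, μ)‖ ≤ α * η ^ 2)
        (_hRlev : ∀ (j : ℕ) (b : Bond d (towerP L m (j + 1))) (w : W), ‖adTransportW φ (UlevOf L m (n + 1) U j) b w‖ ≤ ‖w‖)
        (_hεg : ∀ j < n + 1, εU j ≤ α * ϱ ^ j) (_hAQ : ∑ j ∈ Finset.range (n + 1), αU j ≤ AQ)
        (hpos' : ∀ x : SiteL2K ℂ d (towerP L m (n + 1)) c₀ W, x ≠ 0 → 0 < RCLike.re ⟪x, laplacePrimeAk L m n φ η U a' (c₁ := c₁) x⟫_ℂ)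
        (hpos : ∀ x : BondL2K ℂ d (towerP L m (n + 1)) c₀ W, x ≠ 0 →
          0 < RCLike.re ⟪x, laplaceAk L m n φ η U hL αU hα1 hU1 hreg τ (c₀ := c₀) (c₁ := c₁) a x⟫_ℂ)
        (v : TSite d m) (f : BondL2K ℂ d (towerP L m (n + 1)) c₀ W) (F : ℝ)
        (_hfv : ∀ b, blockCoord (L ^ (n + 1)) m (siteCast (towerP_eq_fineP_pow L m (n + 1)) (bpos b)) ≠ v →
          WL2.equiv ℂ (fun _ : Bond d (towerP L m (n + 1)) => c₀) W f b = 0)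
        (_hfF : ∀ b, ‖WL2.equiv ℂ (fun _ : Bond d (towerP L m (n + 1)) => c₀) W f b‖ ≤ F) (b : Bond d (towerP L m (n + 1))),
        ‖WL2.equiv ℂ (fun _ : Bond d (towerP L m (n + 1)) => c₀) W (G1k L m n φ η U hL αU hα1 hU1 hreg τ (c₀ := c₀) (c₁ := c₁) hpos f) b‖ ≤
          B * Real.exp (-(δ * tdist m (blockCoord (L ^ (n + 1)) m (siteCast (towerP_eq_fineP_pow L m (n + 1)) (bpos b))) v)) * F := by
  classical
  -- the four `∃`-first suppliers
  obtain ⟨αA, BA, δA, hαA, hBA, hδA, HA⟩ := exists_sup_decay_localInvK_diagonal_closed hd L hL hL3 φ hMφ hMφ' hφ hφ' hstar ha ha' hϱ0 hϱ1 τ hτ hCτ hτm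
    hMτ hρw hτ₁ hτ₂ hφτ AQ
  obtain ⟨αG, r₁, A₁, hαG, hr₁, hA₁, HG⟩ := exists_block_decay_G1k_diagonal_closed hd L hL hL3 φ hMφ hMφ' hφ hφ' hstar ha ha' hϱ0 hϱ1 τ hτ hCτ hτm hMτ
    hρw hτ₁ hτ₂ hφτ
  obtain ⟨αC, BC, ρC, hαC, hBC, hρC, HC⟩ := exists_local_letter_QGGQInvk_closed hd L hL hL3 φ hMφ hMφ' hφ hφ' ha ha' hϱ0 hϱ1 τ hτ hCτ hρw hτ₁ hτ₂ hφτ hMτ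
  obtain ⟨αB, BU, κU, hαB, hBU, hκU, HB⟩ := HU
  -- one window, one rate
  set αs : ℝ := min (min αA αG) (min αC αB) with hαs
  have hαs0 : 0 < αs := lt_min (lt_min hαA hαG) (lt_min hαC hαB)
  set κ : ℝ := min (min δA r₁) (min ρC κU) with hκdef
  have hκ0 : 0 < κ := lt_min (lt_min hδA hr₁) (lt_min hρC hκU)
  have hκA : κ ≤ δA := (min_le_left _ _).trans (min_le_left _ _)
  have hκG : κ ≤ r₁ := (min_le_left _ _).trans (min_le_right _ _)
  have hκC : κ ≤ ρC := (min_le_right _ _).trans (min_le_left _ _)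
  have hκB : κ ≤ κU := (min_le_right _ _).trans (min_le_right _ _)
  set K : ℝ := latticeConst d ((κ - κ / 2) / 2) with hKdef
  set Bs : ℝ := BA + BA * BU * BC * (BU * BA * K * d) * K ^ 3 * (1 + BC * ((BU * Real.sqrt d) * A₁ * (BU * Real.sqrt d) * K ^ 2 * 1) * K ^ 2)
    with hBs
  have hK0 : 0 ≤ K := latticeConst_nonneg d (div_nonneg (by linarith) (by norm_num))
  have hBs0 : 0 ≤ Bs := by positivity
  refine ⟨αs, Bs, κ / 2, hαs0, hBs0, by positivity, ?_⟩
  intro n η hηL c₀ c₁ _ _ hw hρ m _ hm U αU hα0 hα1 hU1 hreg εU hεU hUε hLb α hα hαle hUst hUb hUη hpl hUgrad hRlev hεg hAQ hpos' hpos v f F hfv hfF b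
  have hc₀ : (0 : ℝ) < c₀ := Fact.out
  have hc₁ : (0 : ℝ) < c₁ := Fact.out
  have hF0 : 0 ≤ F := (norm_nonneg _).trans (hfF b)
  have hRS : ∀ (b : Bond d (towerP L m (n + 1))) (v u : W), ⟪adTransportW φ U b v, u⟫_ℂ = ⟪v, adTransportW φ (fun b => (U b)⁻¹) b u⟫_ℂ :=
    adTransportW_adjoint φ τ hτ₂ hUst hφτ
  -- the local part, its positivity, the Woodbury letters
  obtain ⟨A₀, hA₀⟩ : ∃ A₀ : BondL2K ℂ d (towerP L m (n + 1)) c₀ W →ₗ[ℂ] BondL2K ℂ d (towerP L m (n + 1)) c₀ W,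
      A₀ = hessOp φ η U τ + covDerivL2K ℂ c₀ ((η : ℂ))⁻¹ (adTransportW φ U) ∘ₗ covDivL2K ℂ c₀ ((η : ℂ))⁻¹ (adTransportW φ fun b => (U b)⁻¹) +
        LinearMap.adjoint (QkW L m n φ U hL αU hα1 hU1 hreg (c₀ := c₀) (c₁ := c₁)) ∘ₗ ((a : ℂ) • QkW L m n φ U hL αU hα1 hU1 hreg (c₀ := c₀) (c₁ := c₁)) :=
    ⟨_, rfl⟩
  have hpos₀ : ∀ x : BondL2K ℂ d (towerP L m (n + 1)) c₀ W, x ≠ 0 → 0 < RCLike.re ⟪x, A₀ x⟫_ℂ :=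
    localK_pos_of_pos L m n φ η U τ hRS hL αU hα1 hU1 hreg a A₀ hA₀ hpos
  obtain ⟨Uu, hUu⟩ : ∃ Uu : SiteL2K ℂ d m c₁ W →ₗ[ℂ] BondL2K ℂ d (towerP L m (n + 1)) c₀ W,
      Uu = covDerivL2K ℂ c₀ ((η : ℂ))⁻¹ (adTransportW φ U) ∘ₗ GpOfUk L m n φ η U a' (c₁ := c₁) hpos' ∘ₗ
        LinearMap.adjoint ((WL2.linearEquiv ℂ ℂ (fun _ : TSite d m => c₁)).symm.toLinearMap ∘ₗ QprimeTowerW L m n φ U (c₀ := c₀)) := ⟨_, rfl⟩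
  obtain ⟨V, hV⟩ : ∃ V : BondL2K ℂ d (towerP L m (n + 1)) c₀ W →ₗ[ℂ] SiteL2K ℂ d m c₁ W,
      V = ((WL2.linearEquiv ℂ ℂ (fun _ : TSite d m => c₁)).symm.toLinearMap ∘ₗ QprimeTowerW L m n φ U (c₀ := c₀)) ∘ₗ
        GpOfUk L m n φ η U a' (c₁ := c₁) hpos' ∘ₗ covDivL2K ℂ c₀ ((η : ℂ))⁻¹ (adTransportW φ fun b => (U b)⁻¹) := ⟨_, rfl⟩
  obtain ⟨c, hc⟩ : ∃ c : SiteL2K ℂ d m c₁ W →ₗ[ℂ] SiteL2K ℂ d m c₁ W, c = greenK _ (QGGQk_pos L m n φ c₀ η U c₁ a' hRS hpos') := ⟨_, rfl⟩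
  have hWST := G1k_eq_woodbury L m n φ c₀ η U c₁ a' τ hRS hpos' hL αU hα1 hU1 hreg a A₀ hA₀ Uu hUu V hV hpos hpos₀
  -- the block families
  obtain ⟨PB, hPB⟩ := exists_block_clm_family (𝕜 := ℂ) (w := fun _ : Bond d (towerP L m (n + 1)) => c₀) (V := W)
    (fun b : Bond d (towerP L m (n + 1)) => blockCoord (L ^ (n + 1)) m (siteCast (towerP_eq_fineP_pow L m (n + 1)) (bpos b)))
  obtain ⟨rY, hrY⟩ := exists_block_clm_family (𝕜 := ℂ) (w := fun _ : TSite d m => c₁) (V := W) (id : TSite d m → TSite d m)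
  -- the CLMs
  obtain ⟨Acl, hAcl⟩ : ∃ T : BondL2K ℂ d (towerP L m (n + 1)) c₀ W →L[ℂ] BondL2K ℂ d (towerP L m (n + 1)) c₀ W,
      T = LinearMap.toContinuousLinearMap (greenK A₀ hpos₀) := ⟨_, rfl⟩
  obtain ⟨Gcl, hGcl⟩ : ∃ T : BondL2K ℂ d (towerP L m (n + 1)) c₀ W →L[ℂ] BondL2K ℂ d (towerP L m (n + 1)) c₀ W,
      T = LinearMap.toContinuousLinearMap (G1k L m n φ η U hL αU hα1 hU1 hreg τ (c₀ := c₀) (c₁ := c₁) hpos) := ⟨_, rfl⟩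
  obtain ⟨Ucl, hUcl⟩ : ∃ T : SiteL2K ℂ d m c₁ W →L[ℂ] BondL2K ℂ d (towerP L m (n + 1)) c₀ W, T = LinearMap.toContinuousLinearMap Uu := ⟨_, rfl⟩
  obtain ⟨Vcl, hVcl⟩ : ∃ T : BondL2K ℂ d (towerP L m (n + 1)) c₀ W →L[ℂ] SiteL2K ℂ d m c₁ W, T = LinearMap.toContinuousLinearMap V := ⟨_, rfl⟩
  obtain ⟨Ccl, hCcl⟩ : ∃ T : SiteL2K ℂ d m c₁ W →L[ℂ] SiteL2K ℂ d m c₁ W, T = LinearMap.toContinuousLinearMap c := ⟨_, rfl⟩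
  -- hW pointwise
  have hW : ∀ f', Gcl f' = Acl f' + Acl (Ucl ((Ccl + Ccl ∘L Vcl ∘L Gcl ∘L Ucl ∘L Ccl) (Vcl (Acl f')))) := fun f' => by
    have e := congrArg (fun T : BondL2K ℂ d (towerP L m (n + 1)) c₀ W →ₗ[ℂ] BondL2K ℂ d (towerP L m (n + 1)) c₀ W => T f') hWST
    simp only [LinearMap.add_apply, LinearMap.comp_apply] at e
    simp only [hAcl, hGcl, hUcl, hVcl, hCcl, hc, add_apply, ContinuousLinearMap.comp_apply, LinearMap.coe_toContinuousLinearMap']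
    exact e
  -- the adjoint facts
  have hVadj : ContinuousLinearMap.adjoint Ucl = Vcl := by
    rw [hUcl, hVcl]; exact adjoint_toContinuousLinearMap_Uu L m n φ c₀ η U c₁ a' hRS hpos' Uu hUu V hV
  have hAadj : ContinuousLinearMap.adjoint Acl = Acl := by
    rw [hAcl]; exact (adjoint_localInvK L m n φ c₀ η U c₁ τ hL αU hα1 hU1 hreg a hUst hτ₁ hτ₂ hφτ A₀ hA₀ hpos₀).2
  -- the four letters at this height, weakened to the common rate `κ`
  have hAk : ∀ (v : TSite d m) (f : BondL2K ℂ d (towerP L m (n + 1)) c₀ W) (F : ℝ),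
      (∀ x, blockCoord (L ^ (n + 1)) m (siteCast (towerP_eq_fineP_pow L m (n + 1)) (bpos x)) ≠ v →
        WL2.equiv ℂ (fun _ : Bond d (towerP L m (n + 1)) => c₀) W f x = 0) →
      (∀ x, ‖WL2.equiv ℂ (fun _ : Bond d (towerP L m (n + 1)) => c₀) W f x‖ ≤ F) →
      ∀ x, ‖WL2.equiv ℂ (fun _ : Bond d (towerP L m (n + 1)) => c₀) W (Acl f) x‖ ≤
        BA * Real.exp (-(κ * tdist m (blockCoord (L ^ (n + 1)) m (siteCast (towerP_eq_fineP_pow L m (n + 1)) (bpos x))) v)) * F := by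
    intro v f F hfv hfF x
    have hF : 0 ≤ F := (norm_nonneg _).trans (hfF x)
    have h := HA n η hηL c₀ c₁ hw hρ m hm U αU hα0 hα1 hU1 hreg εU hεU hUε hLb α hα (hαle.trans ((min_le_left _ _).trans (min_le_left _ _)))
      hUst hUb hUη hpl hεg hAQ A₀ hA₀ hpos₀ PB hPB v f hfv F hF hfF x
    rw [hAcl, LinearMap.coe_toContinuousLinearMap']
    exact h.trans (mul_le_mul_of_nonneg_right (mul_le_mul_of_nonneg_left (exp_weaken hκA (tdist_nonneg m _ _)) hBA) hF)
  have hUk : ∀ (v : TSite d m) (g : SiteL2K ℂ d m c₁ W) (F : ℝ), (∀ u, id u ≠ v → WL2.equiv ℂ (fun _ : TSite d m => c₁) W g u = 0) →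
      (∀ u, ‖WL2.equiv ℂ (fun _ : TSite d m => c₁) W g u‖ ≤ F) →
      ∀ x, ‖WL2.equiv ℂ (fun _ : Bond d (towerP L m (n + 1)) => c₀) W (Ucl g) x‖ ≤
        BU * Real.exp (-(κ * tdist m (blockCoord (L ^ (n + 1)) m (siteCast (towerP_eq_fineP_pow L m (n + 1)) (bpos x))) v)) * F := by
    intro v g F hgv hgF x
    obtain ⟨y₀⟩ : Nonempty (TSite d m) := ⟨v⟩
    have hF : 0 ≤ F := (norm_nonneg _).trans (hgF v)
    have h := HB n η hηL c₀ c₁ hw hρ m hm U αU hα0 hα1 hU1 hreg εU hεU hUε hLb α hα (hαle.trans ((min_le_right _ _).trans (min_le_right _ _)))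
      hUst hUb hUη hpl hUgrad hRlev hεg hAQ hpos' v g F (fun y hy => hgv y hy) hgF x
    rw [hUcl, LinearMap.coe_toContinuousLinearMap', hUu]
    exact h.trans (mul_le_mul_of_nonneg_right (mul_le_mul_of_nonneg_left (exp_weaken hκB (tdist_nonneg m _ _)) hBU) hF)
  have hCk : ∀ (v : TSite d m) (g : SiteL2K ℂ d m c₁ W) (F : ℝ), (∀ u, id u ≠ v → WL2.equiv ℂ (fun _ : TSite d m => c₁) W g u = 0) →
      (∀ u, ‖WL2.equiv ℂ (fun _ : TSite d m => c₁) W g u‖ ≤ F) →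
      ∀ u, ‖WL2.equiv ℂ (fun _ : TSite d m => c₁) W (Ccl g) u‖ ≤ BC * Real.exp (-(κ * tdist m (id u) v)) * F := by
    intro v g F hgv hgF u
    have hF : 0 ≤ F := (norm_nonneg _).trans (hgF v)
    have h := HC n η hηL c₀ c₁ hw hρ m hm U αU hα1 hU1 hreg εU hεU hUε hLb α hα (hαle.trans ((min_le_right _ _).trans (min_le_left _ _)))
      hUst hUb hUη hpl hεg hpos' rY hrY v g F (fun y hy => hgv y hy) hgF u
    rw [hCcl, LinearMap.coe_toContinuousLinearMap', hc]
    exact h.trans (mul_le_mul_of_nonneg_right (mul_le_mul_of_nonneg_left (exp_weaken hκC (tdist_nonneg m _ _)) hBC) hF)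
  have hGk : ∀ z z', ‖PB z' ∘L Gcl ∘L PB z‖ ≤ A₁ * Real.exp (-(κ * tdist m z z')) := by
    intro z z'
    rw [hGcl]
    have h := HG n η hηL c₀ c₁ hw hρ m hm U αU hα0 hα1 hU1 hreg εU hεU hUε hLb α hα (hαle.trans ((min_le_left _ _).trans (min_le_right _ _)))
      hUst hUb hUη hpl hεg hpos PB hPB z z'
    exact h.trans (mul_le_mul_of_nonneg_left (exp_weaken hκG (tdist_nonneg m _ _)) hA₁)
  -- the bond-block mass `d·c₁`
  have hμB : ∀ u : TSite d m, ∑ x : Bond d (towerP L m (n + 1)),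
      (if blockCoord (L ^ (n + 1)) m (siteCast (towerP_eq_fineP_pow L m (n + 1)) (bpos x)) = u then c₀ else 0) ≤ (d : ℝ) * c₁ := by
    intro u
    have h := sum_bondMass_bigBlock_le L m n hc₀.le u
    calc _ ≤ c₀ * (d * ((L : ℝ) ^ (n + 1)) ^ d) := h
      _ = (d : ℝ) * c₁ := by rw [← hw]; ring
  -- the assembly
  haveI : Nonempty (Bond d (towerP L m (n + 1))) := ⟨b⟩
  have hκ' : κ / 2 < κ := by linarith
  have h := local_letter_G1_torus_const (𝕜 := ℂ) (V := W)
    (fun x : Bond d (towerP L m (n + 1)) => blockCoord (L ^ (n + 1)) m (siteCast (towerP_eq_fineP_pow L m (n + 1)) (bpos x))) hPB hrY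
    Acl Gcl Ucl Vcl Ccl hm hW hVadj hAadj (dB := d) hBA hBU hBC hA₁ (by positivity) hκ' hc₁ (fun _ => rfl) (Nat.cast_nonneg d) hμB
    hAk hUk hCk hGk v f F hfv hfF b
  rw [hGcl, LinearMap.coe_toContinuousLinearMap'] at h
  exact h

/-! ## §2 The letter of `Uu = D_UG′_kQ̃′_k†` from the owner's closed gradient row, and THE END -/

include hd hL hL3 hMφ hMφ' hφ hφ' hstar ha ha' hϱ0 hϱ1 hτ hCτ hτm hMτ hρw hτ₁ hτ₂ hφτ in
/-- **THE SUP ROW OF `G₁,k(U)` ON PRINT's DIAGONAL — beta-an4's `exists_local_letter_G1k`, UNCONDITIONAL on the cell's MODEL letters**: §1 with `HU`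
INHABITED by the NE9 owner's `B9Eq342GreenPrimeTowerGradientRowClosed.exists_gradRow_GpOfUk` (the covariant-gradient row of `G′_k`, `∃ (α₂, B, κ′)` before the
height) read on the unit point sources `h = Q̃′_k†g`: support in the big block over `v` (`adjoint_QtildeTower_apply_eq_of_eq_at` against `0` + `bigBlock_eq_iff`),
size `‖h‖_∞ ≤ (c₁∕(c₀L^{(n+1)d}))·‖g‖_∞ = ‖g‖_∞` on the diagonal (`norm_adjoint_QtildeTower_apply_le` × `norm_le_sqrt_mass_mul`), then the tip-block ∕ base-block
junction `d_m(Π(b₋), Π(b₊)) ≤ 1` (`tdist_bigBlock_bpos_btgt_le_one`, factor `e^{κ′}`). [cite: Balaban1985BackgroundPropagators, Thm 3.3 p.399, Thm 3.1 (3.42) p.397,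
(3.25)–(3.26) pp.394–395, (3.19) p.393, Thm 3.11 p.416] -/
theorem exists_local_letter_G1k :
    ∃ α₁ B δ : ℝ, 0 < α₁ ∧ 0 ≤ B ∧ 0 < δ ∧
      ∀ (n : ℕ) (η : ℝ) (_hηL : η * (L : ℝ) ^ (n + 1) = 1) (c₀ c₁ : ℝ) [Fact (0 < c₀)] [Fact (0 < c₁)]
        (_hw : c₀ * ((L : ℝ) ^ (n + 1)) ^ d = c₁) (_hρ : |η| ^ d / c₀ ≤ ρw) (m : Fin d → ℕ) [∀ i, NeZero (m i)] (_hm : ∀ i, 1 ≤ m i)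
        (U : Bond d (towerP L m (n + 1)) → 𝔸ˣ) (αU : ℕ → ℝ) (_hα0 : ∀ j, 0 ≤ αU j) (hα1 : ∀ j, αU j ≤ 1 / 64)
        (hU1 : ∀ (j : ℕ) (x : B7Prop1Explicit.Site d) (k : Fin d), perCfg (towerP L m (j + 1)) (UlevOf L m (n + 1) U j) x k ∈ U1 𝔸)
        (hreg : ∀ (j : ℕ) (y : TSite d (towerP L m j)) (k : Fin d) (ρ' : Fin d → Fin L),
          ‖((Wcx L (perCfg (towerP L m (j + 1)) (UlevOf L m (n + 1) U j)) (cornerSite L y) k (boxVec L ρ') : 𝔸ˣ) : 𝔸) - 1‖ ≤ αU j)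
        (εU : ℕ → ℝ) (_hεU : ∀ j, 0 ≤ εU j) (_hUε : ∀ (j : ℕ) (b : Bond d (towerP L m (j + 1))), ‖(UlevOf L m (n + 1) U j b : 𝔸) - 1‖ ≤ εU j)
        (_hLb : ∀ (j : ℕ) (b : Bond d (towerP L m (j + 1))), UlevOf L m (n + 1) U j b ∈ U1 𝔸)
        (α : ℝ) (_hα : 0 ≤ α) (_hαle : α ≤ α₁)
        (hUst : ∀ b, star (U b : 𝔸) = (((U b)⁻¹ : 𝔸ˣ) : 𝔸)) (_hUb : ∀ b, U b ∈ U1 𝔸) (_hUη : ∀ b, ‖(U b : 𝔸) - 1‖ ≤ α * η)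
        (_hpl : ∀ p : B9SectCLatticeCarrier.Plaq d (towerP L m (n + 1)), ‖(plaqHolU U p : 𝔸) - 1‖ ≤ α * η ^ 2)
        (_hUgrad : ∀ (x : TSite d (towerP L m (n + 1))) (μ : Fin d), ‖(U (x, μ) : 𝔸) - U (unshift μ x, μ)‖ ≤ α * η ^ 2)
        (_hRlev : ∀ (j : ℕ) (b : Bond d (towerP L m (j + 1))) (w : W), ‖adTransportW φ (UlevOf L m (n + 1) U j) b w‖ ≤ ‖w‖)
        (_hεg : ∀ j < n + 1, εU j ≤ α * ϱ ^ j) (_hAQ : ∑ j ∈ Finset.range (n + 1), αU j ≤ AQ)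
        (hpos' : ∀ x : SiteL2K ℂ d (towerP L m (n + 1)) c₀ W, x ≠ 0 → 0 < RCLike.re ⟪x, laplacePrimeAk L m n φ η U a' (c₁ := c₁) x⟫_ℂ)
        (hpos : ∀ x : BondL2K ℂ d (towerP L m (n + 1)) c₀ W, x ≠ 0 →
          0 < RCLike.re ⟪x, laplaceAk L m n φ η U hL αU hα1 hU1 hreg τ (c₀ := c₀) (c₁ := c₁) a x⟫_ℂ)
        (v : TSite d m) (f : BondL2K ℂ d (towerP L m (n + 1)) c₀ W) (F : ℝ)
        (_hfv : ∀ b, blockCoord (L ^ (n + 1)) m (siteCast (towerP_eq_fineP_pow L m (n + 1)) (bpos b)) ≠ v →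
          WL2.equiv ℂ (fun _ : Bond d (towerP L m (n + 1)) => c₀) W f b = 0)
        (_hfF : ∀ b, ‖WL2.equiv ℂ (fun _ : Bond d (towerP L m (n + 1)) => c₀) W f b‖ ≤ F) (b : Bond d (towerP L m (n + 1))),
        ‖WL2.equiv ℂ (fun _ : Bond d (towerP L m (n + 1)) => c₀) W (G1k L m n φ η U hL αU hα1 hU1 hreg τ (c₀ := c₀) (c₁ := c₁) hpos f) b‖ ≤
          B * Real.exp (-(δ * tdist m (blockCoord (L ^ (n + 1)) m (siteCast (towerP_eq_fineP_pow L m (n + 1)) (bpos b))) v)) * F := by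
  classical
  have hL2 : 2 ≤ L := le_trans (by norm_num) hL3
  obtain ⟨α₂, BD, κ', hα₂, hBD, hκ', HD⟩ := exists_gradRow_GpOfUk L φ hMφ hMφ' hφ hφ' ha' hϱ0 hϱ1 τ hτ₂ hφτ hd hL2
  refine exists_local_letter_G1k_of_UuLetter hd L hL hL3 φ hMφ hMφ' hφ hφ' hstar ha ha' hϱ0 hϱ1 τ hτ hCτ hτm hMτ hρw hτ₁ hτ₂ hφτ AQ
    ⟨α₂, BD * Real.exp κ', κ', hα₂, by positivity, hκ', ?_⟩
  intro n η hηL c₀ c₁ _ _ hw hρ m _ hm U αU hα0 hα1 hU1 hreg εU hεU hUε hLb α hα hαle hUst hUb hUη hpl hUgrad hRlev hεg hAQ hpos' v g Gs hgv hgG b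
  have hc₀ : (0 : ℝ) < c₀ := Fact.out
  have hc₁ : (0 : ℝ) < c₁ := Fact.out
  have hG0 : 0 ≤ Gs := (norm_nonneg _).trans (hgG v)
  have hRS : ∀ (b : Bond d (towerP L m (n + 1))) (v u : W), ⟪adTransportW φ U b v, u⟫_ℂ = ⟪v, adTransportW φ (fun b => (U b)⁻¹) b u⟫_ℂ :=
    adTransportW_adjoint φ τ hτ₂ hUst hφτ
  -- the site block family the gradient row wants
  obtain ⟨PS, hPS⟩ := exists_block_clm_family (𝕜 := ℂ) (w := fun _ : TSite d (towerP L m (n + 1)) => c₀) (V := W)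
    (fun x : TSite d (towerP L m (n + 1)) => blockCoord (L ^ (n + 1)) m (siteCast (towerP_eq_fineP_pow L m (n + 1)) x))
  -- `h := Q̃′_k†g`: supported in the big block over `v`, bounded by `G` on the diagonal
  set h : SiteL2K ℂ d (towerP L m (n + 1)) c₀ W :=
    LinearMap.adjoint ((WL2.linearEquiv ℂ ℂ (fun _ : TSite d m => c₁)).symm.toLinearMap ∘ₗ QprimeTowerW L m n φ U (c₀ := c₀)) g with hh
  have hsupp : ∀ x, blockCoord (L ^ (n + 1)) m (siteCast (towerP_eq_fineP_pow L m (n + 1)) x) ≠ v →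
      WL2.equiv ℂ (fun _ : TSite d (towerP L m (n + 1)) => c₀) W h x = 0 := by
    intro x hx
    have e := adjoint_QtildeTower_apply_eq_of_eq_at L m n φ (c₀ := c₀) U g 0 x (fun z hz => by
      have hz' : blockCoord (L ^ (n + 1)) m (siteCast (towerP_eq_fineP_pow L m (n + 1)) x) = z := (bigBlock_eq_iff L m n x z).2 hz
      have hzv : z ≠ v := fun hzv => hx (hz'.trans hzv)
      rw [hgv z hzv, WL2.equiv_zero, Pi.zero_apply])
    rw [hh, e, map_zero, WL2.equiv_zero, Pi.zero_apply]
  have hμ : ∑ y : TSite d m, (if id y = v then c₁ else 0) ≤ c₁ := by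
    show ∑ y : TSite d m, (if y = v then c₁ else 0) ≤ c₁
    rw [Finset.sum_ite_eq' Finset.univ v (fun _ => c₁), if_pos (Finset.mem_univ _)]
  have hgn : ‖g‖ ≤ Real.sqrt c₁ * Gs := norm_le_sqrt_mass_mul (π := id) (w := fun _ : TSite d m => c₁) v hμ g hG0 (fun y hy => hgv y hy) hgG
  have hsize : ∀ x, ‖WL2.equiv ℂ (fun _ : TSite d (towerP L m (n + 1)) => c₀) W h x‖ ≤ Gs := by
    intro x
    have e := norm_adjoint_QtildeTower_apply_le L m n φ (c₀ := c₀) U hRlev g x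
    rw [hh]
    refine e.trans ?_
    have hLp : (0 : ℝ) < ((L : ℝ) ^ (n + 1)) ^ d := by positivity
    calc Real.sqrt c₁ * (((L : ℝ) ^ (n + 1)) ^ d)⁻¹ / c₀ * ‖g‖
        ≤ Real.sqrt c₁ * (((L : ℝ) ^ (n + 1)) ^ d)⁻¹ / c₀ * (Real.sqrt c₁ * Gs) := by gcongr
      _ = c₁ / (c₀ * ((L : ℝ) ^ (n + 1)) ^ d) * Gs := by
          rw [show Real.sqrt c₁ * (((L : ℝ) ^ (n + 1)) ^ d)⁻¹ / c₀ * (Real.sqrt c₁ * Gs) =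
            Real.sqrt c₁ * Real.sqrt c₁ * ((((L : ℝ) ^ (n + 1)) ^ d)⁻¹ / c₀) * Gs by ring, Real.mul_self_sqrt hc₁.le]
          field_simp
      _ = Gs := by rw [← hw, div_self (ne_of_gt (by positivity)), one_mul]
  -- the owner's gradient row at `h`, then the tip → base junction
  have hrow := HD n η hηL c₀ c₁ hw m U hRS α hα hαle hUb hUη hUgrad εU hεU hεg hUε hLb hUst hRlev hpos' PS hPS v h Gs hG0 hsupp hsize b
  have htri := tdist_triangle hm (blockCoord (L ^ (n + 1)) m (siteCast (towerP_eq_fineP_pow L m (n + 1)) (bpos b)))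
    (blockCoord (L ^ (n + 1)) m (siteCast (towerP_eq_fineP_pow L m (n + 1)) (btgt b))) v
  have hone := tdist_bigBlock_bpos_btgt_le_one (L := L) (m := m) (k := n + 1) hm b
  have hexp : Real.exp (-(κ' * tdist m (blockCoord (L ^ (n + 1)) m (siteCast (towerP_eq_fineP_pow L m (n + 1)) (btgt b))) v)) ≤
      Real.exp κ' * Real.exp (-(κ' * tdist m (blockCoord (L ^ (n + 1)) m (siteCast (towerP_eq_fineP_pow L m (n + 1)) (bpos b))) v)) := by
    rw [← Real.exp_add]
    exact Real.exp_le_exp.2 (by nlinarith [hκ'.le])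
  have e : (covDerivL2K ℂ c₀ ((η : ℂ))⁻¹ (adTransportW φ U) ∘ₗ GpOfUk L m n φ η U a' (c₁ := c₁) hpos' ∘ₗ
      LinearMap.adjoint ((WL2.linearEquiv ℂ ℂ (fun _ : TSite d m => c₁)).symm.toLinearMap ∘ₗ QprimeTowerW L m n φ U (c₀ := c₀))) g =
      covDerivL2K ℂ c₀ ((η : ℂ))⁻¹ (adTransportW φ U) (GpOfUk L m n φ η U a' (c₁ := c₁) hpos' h) := by
    rw [hh]; rfl
  rw [e]
  calc _ ≤ BD * Gs * Real.exp (-(κ' * tdist m (blockCoord (L ^ (n + 1)) m (siteCast (towerP_eq_fineP_pow L m (n + 1)) (btgt b))) v)) := hrow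
    _ ≤ BD * Gs * (Real.exp κ' * Real.exp (-(κ' * tdist m (blockCoord (L ^ (n + 1)) m (siteCast (towerP_eq_fineP_pow L m (n + 1)) (bpos b))) v))) :=
        mul_le_mul_of_nonneg_left hexp (mul_nonneg hBD hG0)
    _ = BD * Real.exp κ' * Real.exp (-(κ' * tdist m (blockCoord (L ^ (n + 1)) m (siteCast (towerP_eq_fineP_pow L m (n + 1)) (bpos b))) v)) * Gs := by
        ring

end Literature.MathematicalPhysics.QuantumFieldTheory.Balaban1983to89.B9Eq326G1kSupRowClosed

end
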